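import Literature.MathematicalPhysics.KineticTheory.ConfinedLinearControl
import Literature.MathematicalPhysics.KineticTheory.ConfinedShortTime
import Literature.Probability.Process.BrownianSkeletonLaw
import Literature.Analysis.Calculus.SubmersionLocalMinorization
import Mathlib.MeasureTheory.Measure.Lebesgue.EqHaar
import HarnessLib

/-!
# Additive-noise SDEs with a confined drift: a local small set at a controllable equilibrium (Hörmander-free)

Trunk T-KINETIC (Literature/MathematicalPhysics/KineticTheory). Model-free version of
`LangevinChainLocalMinorization.lean` (there: the pinned chain and the older pipeline): the LOCAL
MINORISATION of the transition probabilities `P_t(z, ·) = law Φ_t(z, B)` of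
`dz = Y(z) dt + v₁ dB¹ + v₂ dB²` (`Y` a confined drift, `ConfinedForcedFlow.lean`,
`ConfinedDriftKernel.lean`) near an EQUILIBRIUM `x₀` (`Y x₀ = 0`) at which the linearised pair
`(DY(x₀), v₁)` satisfies KALMAN's condition, proved without Hörmander's theorem by the
finite-dimensional "partial Malliavin" argument: conditionally on the Brownian bridges
(`BrownianSkeleton.lean`) the solution at time `1` is a `C¹` function of the dyadic skeleton of the
Brownian pair (`ConfinedSkeletonFlow.lean`) whose differential at the base parameter is onto for a
fine enough level (`ConfinedLinearControl.lean`); an onto differential pushes the Gaussian law of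
the skeleton (bounded below by Lebesgue measure on balls, `BrownianSkeletonLaw.lean`) forward to a
measure bounded below by Haar measure near the image point, locally uniformly in the initial
condition and the (small) remainder noise (`SubmersionLocalMinorization.lean`); and the remainders
are small with positive probability (`BrownianSupTail.lean`).

* `ConfinedDrift.sdeSolMap_one_pairRecon_eq_skelSol` — the solution at time `1` through a
  reconstructed pair of paths is the skeleton solution family at the remainder noise path;
* `ConfinedDrift.minorization_at_one` — there are `ε₁, r, c > 0` with `P_1(z, T) ≥ c · Λ(T)` for
  all measurable `T ⊆ B(x₀, r)` and all `z ∈ B(x₀, ε₁)` (`Λ` any additive Haar measure on the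
  state space);
* `ConfinedDrift.exists_smul_restrict_le_sdeKernel_one` — the same in measure form;
* `ConfinedDrift.exists_localSmall_window` — **a LOCAL SMALL SET at the equilibrium in a time
  window**: `P_t(w, ·) ≥ η Λ|_{U₀}` for `w` near `x₀` and `t ∈ [t₀ - δ, t₀ + δ]` (with the
  short-time stay estimate of `ConfinedShortTime.lean`).

The only model inputs are: a confined `C¹` drift, an equilibrium, and Kalman's condition for the
linearisation — for oscillator chains the latter is `OscillatorChain.eq_zero_of_forall_pow_unitP_zero₂`
(`LangevinChainConfinedKalman.lean`).

## References

* N. Cuneo, J.-P. Eckmann, M. Hairer, L. Rey-Bellet, EJP **23** (2018) no. 55, Prop. 3.6 (proof);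
  J. C. Mattingly, É. Pardoux, CPAM **59** (2006), §§3–4 (partial Malliavin / finite-dimensional
  controls); M. Hairer, J. C. Mattingly, CPAM **62** (2009), §3 (the argument is used there for
  the chain of three oscillators). [folklore]
-/

noncomputable section

open MeasureTheory ProbabilityTheory Filter Topology Set Metric Function unitInterval
open scoped NNReal ENNReal

namespace Literature.MathematicalPhysics.KineticTheory

open Literature.Probability.Process Literature.Analysis.ODE Literature.Analysis.Calculus

variable {E : Type*} [NormedAddCommGroup E] [NormedSpace ℝ E]

/-! ### Small lemmas on the skeleton objects -/

/-- The piecewise-linear path starts at `0`. [folklore] -/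
private theorem plInterp_time_zero' (m : ℕ) (y : Fin (2 ^ m) → ℝ) : plInterp m y 0 = 0 := by
  simp [plInterp, tentCoeff]

/-- The remainders of the Brownian pair vanish at time `0`. [folklore] -/
private theorem pairRem_apply_zero' (m : ℕ) (w : WienerPair) :
    (pairRem m w).1 0 = 0 ∧ (pairRem m w).2 0 = 0 := by
  constructor <;> simp [pairRem, bridgeRem, plInterp_time_zero', pairPath]

namespace ConfinedDrift

/-! ### The solution map through a reconstructed pair -/

section Recon

variable [FiniteDimensional ℝ E] [CompleteSpace E] {Y : E → E}
  (D : ConfinedDrift Y) (m : ℕ) {v₁ v₂ : E} (hv₁ : v₁ ∈ D.noise) (hv₂ : v₂ ∈ D.noise)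
include D hv₁ hv₂

/-- **The SDE solution at time `1` through a reconstructed pair**: for a skeleton `x` and a pair
of continuous remainder paths `r` with `r(0) = 0`, `Φ_1(z, PL(x) + r) = S(z, x, ρ_r)(1)` with the
remainder noise path `ρ_r(τ) = r¹_τ v₁ + r²_τ v₂`. [folklore] -/
theorem sdeSolMap_one_pairRecon_eq_skelSol
    {S : E × PairSkeleton m × C(I, D.noise) → C(I, E)}
    (hS : ∀ p τ, S p τ = drivenFlow Y p.1 (skelNoisePath m v₁ v₂ p.2.1 p.2.2) τ)
    (x : PairSkeleton m) {r : WienerPair} (hr1 : Continuous r.1) (hr2 : Continuous r.2)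
    (hr10 : r.1 0 = 0) (hr20 : r.2 0 = 0) (ρr : C(I, D.noise))
    (hρr : ∀ τ : I, (ρr τ : E) = r.1 ⟨(τ : ℝ), τ.2.1⟩ • v₁ + r.2 ⟨(τ : ℝ), τ.2.1⟩ • v₂) (z : E) :
    sdeSolMap Y v₁ v₂ 1 z (pairRecon m x r) = S (z, x, ρr) 1 := by
  have hc1 : Continuous (pairRecon m x r).1 := (continuous_plInterp m x.1).add hr1
  have hc2 : Continuous (pairRecon m x r).2 := (continuous_plInterp m x.2).add hr2
  rw [hS]
  show drivenFlow Y z (pairNoise v₁ v₂ (pairRecon m x r)) 1 =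
    drivenFlow Y z (skelNoisePath m v₁ v₂ x ρr) ((1 : I) : ℝ)
  refine D.flow_congr z (continuous_pairNoise v₁ v₂ _) (continuous_skelNoisePath m v₁ v₂ _ _)
    (fun t => pairNoise_mem v₁ v₂ hv₁ hv₂ _ t) (skelNoisePath_mem m v₁ v₂ hv₁ hv₂ _ _) (T := 1)
    (fun t ht => ?_) ⟨zero_le_one, le_rfl⟩
  rw [pairNoise_of_continuous v₁ v₂ hc1 hc2, skelNoisePath_apply]
  have hproj : projIcc 0 1 zero_le_one t = ⟨t, ht⟩ := projIcc_of_mem zero_le_one ht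
  rw [hproj, hρr]
  have htnn : t.toNNReal = ⟨t, ht.1⟩ := Real.toNNReal_of_nonneg ht.1
  have h10 : (pairRecon m x r).1 0 = 0 := by
    show plInterp m x.1 0 + r.1 0 = 0
    rw [plInterp_time_zero', hr10, add_zero]
  have h20 : (pairRecon m x r).2 0 = 0 := by
    show plInterp m x.2 0 + r.2 0 = 0
    rw [plInterp_time_zero', hr20, add_zero]
  have h1 : (pairRecon m x r).1 t.toNNReal = plInterp m x.1 t.toNNReal + r.1 ⟨t, ht.1⟩ := by
    show plInterp m x.1 t.toNNReal + r.1 t.toNNReal = _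
    rw [htnn]
  have h2 : (pairRecon m x r).2 t.toNNReal = plInterp m x.2 t.toNNReal + r.2 ⟨t, ht.1⟩ := by
    show plInterp m x.2 t.toNNReal + r.2 t.toNNReal = _
    rw [htnn]
  simp only [h10, h20, sub_zero, h1, h2, add_smul]
  abel

end Recon

/-! ### The minorisation at time one -/

section One

variable [FiniteDimensional ℝ E] [CompleteSpace E] [MeasurableSpace E] [BorelSpace E]
  [SecondCountableTopology E] {Y : E → E} (D : ConfinedDrift Y) (hY : ContDiff ℝ 1 Y)
  {x₀ : E} (hx₀ : Y x₀ = 0) {v₁ v₂ : E} (hv₁ : v₁ ∈ D.noise) (hv₂ : v₂ ∈ D.noise)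
  (hKal : ∀ ℓ : E →ₗ[ℝ] ℝ, (∀ k : ℕ, ℓ (((fderiv ℝ Y x₀) ^ k) v₁) = 0) → ℓ = 0)
  (Λ : Measure E) [Λ.IsAddHaarMeasure]
include D hY hx₀ hv₁ hv₂ hKal

/-- **Local minorisation at time one, near a controllable equilibrium** (Hörmander-free): if
`Y x₀ = 0` and `(DY(x₀), v₁)` satisfies Kalman's condition, there are `ε₁, r > 0` and `c > 0` such
that `P_1(z, T) ≥ c · Λ(T)` for every measurable `T ⊆ B(x₀, r)` and every initial condition
`z ∈ B(x₀, ε₁)`. [cite: CuneoEckmannHairerReyBellet2018, Prop 3.6 (proof)] -/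
theorem minorization_at_one :
    ∃ ε₁ : ℝ, 0 < ε₁ ∧ ∃ r : ℝ, 0 < r ∧ ∃ c : ℝ≥0∞, 0 < c ∧
      ∀ z ∈ ball x₀ ε₁, ∀ T ⊆ ball x₀ r, MeasurableSet T →
        c * Λ T ≤ sdeKernel Y v₁ v₂ 1 z T := by
  classical
  -- the level `m` and the skeleton objects
  obtain ⟨m, hm⟩ := D.exists_skeleton_level_surjective hY hx₀ hv₁ hv₂ hKal
  obtain ⟨g, hg⟩ := exists_skelForcingCLM (F := D.noise) m v₁ v₂
  obtain ⟨S, hSapply, hS, huniq, hdiff⟩ := D.exists_skelSol m hv₁ hv₂ g hg le_rfl hY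
  have hS0 : S (x₀, 0, 0) = ContinuousMap.const I x₀ := D.skelSol_equilibrium m hSapply hx₀
  have hsurjT := hm g hg S hS huniq
  -- the map `f (z, ρ) x = S (z, x, ρ) 1` and its partial differential in `x`
  let ι : PairSkeleton m →L[ℝ] E × PairSkeleton m × C(I, D.noise) :=
    (ContinuousLinearMap.inr ℝ E (PairSkeleton m × C(I, D.noise))).comp
      (ContinuousLinearMap.inl ℝ (PairSkeleton m) C(I, D.noise))
  have hι : ∀ x : PairSkeleton m, ι x = ((0 : E), x, (0 : C(I, D.noise))) := fun x => rfl
  let f : E × C(I, D.noise) → PairSkeleton m → E := fun p x => S (p.1, x, p.2) 1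
  let f' : E × C(I, D.noise) → PairSkeleton m → PairSkeleton m →L[ℝ] E :=
    fun p x => (ContinuousMap.evalCLM ℝ (1 : I)).comp ((fderiv ℝ S (p.1, x, p.2)).comp ι)
  have hSd : Differentiable ℝ S := hdiff.differentiable one_ne_zero
  have hf' : ∀ p x, HasFDerivAt (f p) (f' p x) x := by
    intro p x
    have hA : HasFDerivAt (fun x : PairSkeleton m => (p.1, x, p.2)) ι x := by
      have h1 : (fun x : PairSkeleton m => (p.1, x, p.2)) = fun x => ι x + (p.1, 0, p.2) := by
        funext x; rw [hι]; simp
      rw [h1]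
      exact ι.hasFDerivAt.add_const _
    have hSx := (hSd (p.1, x, p.2)).hasFDerivAt.comp x hA
    exact (ContinuousMap.evalCLM ℝ (1 : I)).hasFDerivAt.comp x hSx
  have hcontf' : Continuous fun q : (E × C(I, D.noise)) × PairSkeleton m => f' q.1 q.2 := by
    have h1 : Continuous fun q : (E × C(I, D.noise)) × PairSkeleton m =>
        fderiv ℝ S (q.1.1, q.2, q.1.2) :=
      (hdiff.continuous_fderiv one_ne_zero).comp (by fun_prop)
    exact continuous_const.clm_comp (h1.clm_comp continuous_const)
  have hcontf : Continuous fun p : E × C(I, D.noise) => f p 0 :=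
    (ContinuousMap.evalCLM ℝ (1 : I)).continuous.comp (hdiff.continuous.comp (by fun_prop))
  have hf00 : f (x₀, 0) 0 = x₀ := by
    show S (x₀, (0 : PairSkeleton m), (0 : C(I, D.noise))) 1 = x₀
    rw [hS0]
    rfl
  have hsurj : LinearMap.range (f' (x₀, 0) 0 : PairSkeleton m →ₗ[ℝ] E) = ⊤ := hsurjT
  -- nontriviality of the skeleton space
  haveI : Nontrivial (PairSkeleton m) := by
    refine ⟨⟨0, (fun _ => 1, 0), fun h => ?_⟩⟩
    have := congrArg (fun q : PairSkeleton m => q.1 ⟨0, Nat.two_pow_pos m⟩) h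
    simp at this
  -- Haar instances on the skeleton space
  haveI hpiS : (volume : Measure (Fin (2 ^ m) → ℝ)).IsAddHaarMeasure := isAddHaarMeasure_volume_pi _
  haveI hvolS : (volume : Measure (PairSkeleton m)).IsAddHaarMeasure :=
    Measure.prod.instIsAddHaarMeasure (volume : Measure (Fin (2 ^ m) → ℝ))
      (volume : Measure (Fin (2 ^ m) → ℝ))
  -- the submersion estimate, uniformly in `(z, ρ)` near `(x₀, 0)`
  obtain ⟨V, hV, ρ₀, hρ₀, r, hr, c, hc, hmin⟩ :=
    exists_measure_preimage_ge_of_surjective (volume : Measure (PairSkeleton m)) Λ f f'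
      (Eventually.of_forall fun q => hf' q.1 q.2) hcontf'.continuousAt hcontf.continuousAt hsurj
  rw [hf00] at hmin
  obtain ⟨ε₁, hε₁, hε₁V⟩ := Metric.mem_nhds_iff.1 hV
  -- the law of the skeleton dominates Lebesgue measure on the ball of radius `ρ₀`
  obtain ⟨c₂, hc₂, hskel⟩ := exists_wienerPair_map_pairSkel_ge m ρ₀
  -- the good remainders
  have hCpos : 0 < (‖v₁‖ + ‖v₂‖ + 1) * (1 + 2 * 2 ^ m) := by positivity
  set ε' : ℝ := ε₁ / 2 / ((‖v₁‖ + ‖v₂‖ + 1) * (1 + 2 * 2 ^ m)) with hε'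
  have hε'pos : 0 < ε' := by positivity
  have hε'bound : (‖v₁‖ + ‖v₂‖) * ((1 + 2 * 2 ^ m) * ε') < ε₁ := by
    have h1 : (‖v₁‖ + ‖v₂‖) * ((1 + 2 * 2 ^ m) * ε') ≤ (‖v₁‖ + ‖v₂‖ + 1) * ((1 + 2 * 2 ^ m) * ε') :=
      mul_le_mul_of_nonneg_right (by linarith) (by positivity)
    have h2 : (‖v₁‖ + ‖v₂‖ + 1) * ((1 + 2 * 2 ^ m) * ε') = ε₁ / 2 := by
      rw [hε']; field_simp
    linarith
  -- the set of good remainder pairs (countably many conditions: measurable)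
  set GoodR : Set WienerPair := {rr | (∀ n k : ℕ, ((k : ℝ≥0) / 2 ^ n ≤ 1) →
      |rr.1 ((k : ℝ≥0) / 2 ^ n)| ≤ (1 + 2 * 2 ^ m) * ε' ∧ |rr.2 ((k : ℝ≥0) / 2 ^ n)| ≤ (1 + 2 * 2 ^ m) * ε')}
    with hGoodR
  have hGoodRm : MeasurableSet GoodR := by
    have : GoodR = ⋂ n : ℕ, ⋂ k : ℕ, {rr : WienerPair | ((k : ℝ≥0) / 2 ^ n ≤ 1) →
        |rr.1 ((k : ℝ≥0) / 2 ^ n)| ≤ (1 + 2 * 2 ^ m) * ε' ∧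
          |rr.2 ((k : ℝ≥0) / 2 ^ n)| ≤ (1 + 2 * 2 ^ m) * ε'} := by
      ext rr; simp [hGoodR]
    rw [this]
    refine MeasurableSet.iInter fun n => MeasurableSet.iInter fun k => ?_
    by_cases hkn : (k : ℝ≥0) / 2 ^ n ≤ 1
    · simp only [hkn, forall_const]
      exact (measurableSet_le ((measurable_pi_apply _).comp measurable_fst).abs measurable_const).inter
        (measurableSet_le ((measurable_pi_apply _).comp measurable_snd).abs measurable_const)
    · simp [hkn]
  -- the good event of the Brownian pair forces a good remainder
  have hgood_sub : goodEvent ε' 1 ⊆ (pairRem m) ⁻¹' GoodR := by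
    intro w hw n k hk
    exact abs_pairRem_le_of_mem_goodEvent m hw hk
  have hgood_pos : 0 < wienerPair (goodEvent ε' 1) := wienerPair_goodEvent_pos hε'pos 1
  -- the constant
  refine ⟨ε₁, hε₁, r, hr, c₂ * c * wienerPair (goodEvent ε' 1),
    ENNReal.mul_pos (ENNReal.mul_pos hc₂.ne' hc.ne').ne' hgood_pos.ne', fun z hz T hT hTm => ?_⟩
  -- the transition probability as a Wiener integral, factorised through the skeleton
  have hkernel : sdeKernel Y v₁ v₂ 1 z T =
      wienerPair ((fun w => sdeSolMap Y v₁ v₂ 1 z (pairPath w)) ⁻¹' T) := by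
    have h := D.sdeKernel_apply' hv₁ hv₂ 1 z hTm
    simpa using h
  -- the integrand `G(x, rr) = 1_T(Φ_1(z, PL x + rr)) 1_{GoodR}(rr)`
  have h1m := D.measurable_sdeSolMap hv₁ hv₂ (1 : ℝ)
  have h2m : Measurable fun q : PairSkeleton m × WienerPair => ((z : E), pairRecon m q.1 q.2) :=
    measurable_const.prodMk (measurable_pairRecon m)
  have hsolm : Measurable ((fun p : E × WienerPair => sdeSolMap Y v₁ v₂ 1 p.1 p.2) ∘
      (fun q : PairSkeleton m × WienerPair => ((z : E), pairRecon m q.1 q.2))) :=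
    Measurable.comp h1m h2m
  let G : PairSkeleton m × WienerPair → ℝ≥0∞ := fun q =>
    ((T.indicator (1 : E → ℝ≥0∞)) ∘ ((fun p : E × WienerPair => sdeSolMap Y v₁ v₂ 1 p.1 p.2) ∘
      (fun q : PairSkeleton m × WienerPair => ((z : E), pairRecon m q.1 q.2)))) q *
      GoodR.indicator 1 q.2
  have hGm : Measurable G :=
    ((measurable_one.indicator hTm).comp hsolm).mul ((measurable_one.indicator hGoodRm).comp measurable_snd)
  -- `G(Ξ ω, R ω) ≤ 1_{Φ_1(z, B ω) ∈ T}`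
  have hGle : ∀ w, G (pairSkel m w, pairRem m w) ≤
      ((fun w => sdeSolMap Y v₁ v₂ 1 z (pairPath w)) ⁻¹' T).indicator 1 w := by
    intro w
    simp only [G, Function.comp_apply]
    rw [pairRecon_pairSkel_pairRem]
    by_cases hmem : sdeSolMap Y v₁ v₂ 1 z (pairPath w) ∈ T
    · rw [indicator_of_mem hmem, indicator_of_mem
        (show w ∈ (fun w => sdeSolMap Y v₁ v₂ 1 z (pairPath w)) ⁻¹' T from hmem)]
      simp only [Pi.one_apply, one_mul]
      exact indicator_le_self' (fun _ _ => zero_le_one) _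
    · rw [indicator_of_notMem hmem, zero_mul]
      exact zero_le
  -- for a good remainder of the Brownian pair, the inner integral is at least `c₂ c Λ(T)`
  have hinner : ∀ w, pairRem m w ∈ GoodR →
      c₂ * c * Λ T ≤ ∫⁻ x, G (x, pairRem m w) ∂(wienerPair.map (pairSkel m)) := by
    intro w hwR
    set rr := pairRem m w with hrr
    have hr1 : Continuous rr.1 := continuous_pairRem_fst m w
    have hr2 : Continuous rr.2 := continuous_pairRem_snd m w
    obtain ⟨hr10, hr20⟩ := pairRem_apply_zero' m w
    -- the remainder noise path and its smallness
    let ρr : C(I, D.noise) := remNoisePath m hv₁ hv₂ w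
    have hρr : ∀ τ : I, (ρr τ : E) = rr.1 ⟨(τ : ℝ), τ.2.1⟩ • v₁ + rr.2 ⟨(τ : ℝ), τ.2.1⟩ • v₂ :=
      fun τ => remNoisePath_apply m hv₁ hv₂ w τ
    have hsmall : ∀ u : ℝ≥0, u ≤ 1 →
        |rr.1 u| ≤ (1 + 2 * 2 ^ m) * ε' ∧ |rr.2 u| ≤ (1 + 2 * 2 ^ m) * ε' := by
      intro u hu
      exact ⟨abs_le_of_dyadic hr1 (fun n k hk => (hwR n k hk).1) hu,
        abs_le_of_dyadic hr2 (fun n k hk => (hwR n k hk).2) hu⟩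
    have hρnorm : ‖ρr‖ < ε₁ := by
      refine (ContinuousMap.norm_lt_iff _ hε₁).2 fun τ => ?_
      rw [Submodule.coe_norm, hρr]
      obtain ⟨h1, h2⟩ := hsmall ⟨(τ : ℝ), τ.2.1⟩ (by exact_mod_cast τ.2.2)
      have hL' : ‖rr.1 ⟨(τ : ℝ), τ.2.1⟩ • v₁‖ ≤ ‖v₁‖ * ((1 + 2 * 2 ^ m) * ε') := by
        rw [norm_smul, Real.norm_eq_abs, mul_comm]
        exact mul_le_mul_of_nonneg_left h1 (norm_nonneg _)
      have hR' : ‖rr.2 ⟨(τ : ℝ), τ.2.1⟩ • v₂‖ ≤ ‖v₂‖ * ((1 + 2 * 2 ^ m) * ε') := by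
        rw [norm_smul, Real.norm_eq_abs, mul_comm]
        exact mul_le_mul_of_nonneg_left h2 (norm_nonneg _)
      calc _ ≤ ‖rr.1 ⟨(τ : ℝ), τ.2.1⟩ • v₁‖ + ‖rr.2 ⟨(τ : ℝ), τ.2.1⟩ • v₂‖ := norm_add_le _ _
        _ ≤ ‖v₁‖ * ((1 + 2 * 2 ^ m) * ε') + ‖v₂‖ * ((1 + 2 * 2 ^ m) * ε') := add_le_add hL' hR'
        _ = (‖v₁‖ + ‖v₂‖) * ((1 + 2 * 2 ^ m) * ε') := by ring
        _ < ε₁ := hε'bound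
    -- `(z, ρr) ∈ V`
    have hzρ : ((z, ρr) : E × C(I, D.noise)) ∈ V := by
      refine hε₁V ?_
      rw [mem_ball, Prod.dist_eq, max_lt_iff, dist_zero_right]
      exact ⟨mem_ball.1 hz, hρnorm⟩
    -- the inner integrand is the indicator of `{x | f (z, ρr) x ∈ T}`
    have hGeq : ∀ x, G (x, rr) = ((f (z, ρr)) ⁻¹' T).indicator 1 x := by
      intro x
      simp only [G, Function.comp_apply]
      rw [indicator_of_mem hwR, Pi.one_apply, mul_one,
        D.sdeSolMap_one_pairRecon_eq_skelSol m hv₁ hv₂ hSapply x hr1 hr2 hr10 hr20 ρr hρr z]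
      rfl
    simp_rw [hGeq]
    have hfTm : MeasurableSet ((f (z, ρr)) ⁻¹' T) :=
      ((hf' (z, ρr) ·) |> fun h => (continuous_iff_continuousAt.2 fun x => (h x).continuousAt)).measurable hTm
    rw [lintegral_indicator_one hfTm]
    calc c₂ * c * Λ T = c₂ * (c * Λ T) := mul_assoc _ _ _
      _ ≤ c₂ * volume (closedBall (0 : PairSkeleton m) ρ₀ ∩ f (z, ρr) ⁻¹' T) :=
          mul_le_mul' le_rfl (hmin (z, ρr) hzρ T hT hTm)
      _ ≤ wienerPair.map (pairSkel m) (closedBall (0 : PairSkeleton m) ρ₀ ∩ f (z, ρr) ⁻¹' T) :=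
          hskel _ inter_subset_left (measurableSet_closedBall.inter hfTm)
      _ ≤ wienerPair.map (pairSkel m) (f (z, ρr) ⁻¹' T) := measure_mono inter_subset_right
  -- assemble: Wiener integral ≥ factorised integral ≥ good part
  rw [hkernel, ← lintegral_indicator_one ((hTm.preimage
    (D.measurable_sdeSolMap_pairPath_right hv₁ hv₂ 1 z)))]
  calc c₂ * c * wienerPair (goodEvent ε' 1) * Λ T
      = c₂ * c * Λ T * wienerPair (goodEvent ε' 1) := by ring
    _ ≤ c₂ * c * Λ T * wienerPair ((pairRem m) ⁻¹' GoodR) := by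
        gcongr
    _ = ∫⁻ w, ((pairRem m) ⁻¹' GoodR).indicator (fun _ => c₂ * c * Λ T) w ∂wienerPair := by
        rw [lintegral_indicator_const (hGoodRm.preimage (measurable_pairRem m))]
    _ ≤ ∫⁻ w, ∫⁻ x, G (x, pairRem m w) ∂(wienerPair.map (pairSkel m)) ∂wienerPair := by
        refine lintegral_mono fun w => ?_
        by_cases hwR : pairRem m w ∈ GoodR
        · rw [indicator_of_mem (show w ∈ (pairRem m) ⁻¹' GoodR from hwR)]
          exact hinner w hwR
        · rw [indicator_of_notMem (show w ∉ (pairRem m) ⁻¹' GoodR from hwR)]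
          exact zero_le
    _ = ∫⁻ w, G (pairSkel m w, pairRem m w) ∂wienerPair := (lintegral_pairSkel_pairRem m hGm).symm
    _ ≤ ∫⁻ w, ((fun w => sdeSolMap Y v₁ v₂ 1 z (pairPath w)) ⁻¹' T).indicator 1 w ∂wienerPair :=
        lintegral_mono hGle

/-- **The minorisation at time one in measure form**: `P_1(z, ·) ≥ c Λ|_{B(x₀, r)}` for all
`z ∈ B(x₀, ε₁)`. [cite: CuneoEckmannHairerReyBellet2018, Prop 3.6 (proof)] -/
theorem exists_smul_restrict_le_sdeKernel_one :
    ∃ ε₁ : ℝ, 0 < ε₁ ∧ ∃ r : ℝ, 0 < r ∧ ∃ c : ℝ≥0∞, 0 < c ∧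
      ∀ z ∈ ball x₀ ε₁, c • Λ.restrict (ball x₀ r) ≤ sdeKernel Y v₁ v₂ 1 z := by
  obtain ⟨ε₁, hε₁, r, hr, c, hc, h⟩ := D.minorization_at_one hY hx₀ hv₁ hv₂ hKal Λ
  refine ⟨ε₁, hε₁, r, hr, c, hc, fun z hz => Measure.le_iff.2 fun T hTm => ?_⟩
  rw [Measure.smul_apply, Measure.restrict_apply hTm, smul_eq_mul]
  exact (h z hz (T ∩ ball x₀ r) inter_subset_right (hTm.inter measurableSet_ball)).trans
    (measure_mono inter_subset_left)

/-- **A local small set at a controllable equilibrium, in a time window** (Hörmander-free): if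
`Y x₀ = 0` and `(DY(x₀), v₁)` satisfies Kalman's condition then there are an open neighbourhood
`G₀` of `x₀`, a non-empty open set `U₀`, `η > 0` and a time window `[t₀ - δ, t₀ + δ]`
(`0 < δ ≤ t₀`) with `P_t(w, ·) ≥ η Λ|_{U₀}` for all `w ∈ G₀` and all `t` in the window.
[cite: CuneoEckmannHairerReyBellet2018, Prop 3.6 (proof)] -/
theorem exists_localSmall_window :
    ∃ (G₀ U₀ : Set E) (η : ℝ≥0∞) (t₀ δ : ℝ), IsOpen G₀ ∧ x₀ ∈ G₀ ∧ IsOpen U₀ ∧ U₀.Nonempty ∧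
      0 < η ∧ 0 < δ ∧ δ ≤ t₀ ∧ ∀ t : ℝ≥0, t₀ - δ ≤ (t : ℝ) → (t : ℝ) ≤ t₀ + δ →
        ∀ w ∈ G₀, η • Λ.restrict U₀ ≤ sdeKernel Y v₁ v₂ t w := by
  obtain ⟨ε₁, hε₁, r, hr, c, hc, hmin⟩ := D.exists_smul_restrict_le_sdeKernel_one hY hx₀ hv₁ hv₂ hKal Λ
  obtain ⟨δ, hδ, hwin⟩ := D.exists_window_smul_restrict_le_sdeKernel hv₁ hv₂ x₀ hε₁ (t₁ := 1) hmin
  refine ⟨ball x₀ (ε₁ / 2), ball x₀ r, 2⁻¹ * c, 1 + δ / 2, δ / 2, isOpen_ball,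
    mem_ball_self (half_pos hε₁), isOpen_ball, ⟨x₀, mem_ball_self hr⟩,
    ENNReal.mul_pos (by simp) hc.ne', half_pos hδ, by linarith, fun t ht1 ht2 w hw => ?_⟩
  refine hwin t ?_ ?_ w hw
  · rw [NNReal.coe_one]; linarith
  · rw [NNReal.coe_one]; linarith

end One

end ConfinedDrift

end Literature.MathematicalPhysics.KineticTheory

end
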